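/-
Copyright (c) 2026 the pub-hodgecm-mathlib formalisation cell (harness21).  Prover seat hodgecm-mathlib-K2Liu-p02 (g4), Track B «K2-LIT» ∕
hLiu418 #184♮, socket #42R `sig_K2LiuEisensteinResidueIsThetaIntegral`, DEFS leaf (I1) «IKEDA MAP» (LEAD F0P6-plan (g11) ruling «M-155k» (2)–(3),
2026-09-04).
-/
import Literature.NumberTheory.Weil1964.AdelicMetaplecticReindex
import Summits.HodgeConjecture.HodgeConjecture.Theorems.K2LiuSchwartzBruhatFibreIntegralDefs

/-!
# Crux `HLiu418`, road `K2_Liu`, socket #42R ∕ #42F — DEFS leaf (I1): the IKEDA MAP as a composite linear map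
# `𝒮(𝔸_K^ι) →ₗ[ℂ] 𝒮(𝔸_K^{ι₀})` (big mover ∘ block split ∘ restriction ∘ fibre integral ∘ small mover)

Cell `hodgecm-mathlib`, crux item hLiu418 = `stmt-HodgeConjecture-24832`; squad K2 ∕ K2Liu, LEAD F0P6-plan (g11) RULING «M-155k» (2) «IKEDA OF RECORD»
and (3) deal (I1), prover K2Liu-p02 (g4), steward lineage of socket #42R.  DEFINITIONS WITH BODIES + `rfl` API (no instance ∕ notation ∕ named-fact
hypothesis ∕ `sorry`, default heartbeats); lane `--supports stmt-HodgeConjecture-24832 --as helper` (count-neutral; definitions ⇒ review lane).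

THE PRINTED OBJECT.  [GanQiuTakeda2014, §2.7]: for `V_r = X′ ⊕ V_{r′} ⊕ X′*`, Ikeda's map `Ik^{n,r,r′} : 𝒮(Y_n* ⊗ V_r)(𝔸) → 𝒮(Y_n* ⊗ V_{r′})(𝔸)`,
`Ik(φ)(a) = ∫_{(Y_n*⊗X′)(𝔸)} φ(x, a, 0) dx` — in the LINEAR Schrödinger model; it is `G_n × H_{r′}`-equivariant (§2.8) and carries the first-term
identity [GanQiuTakeda2014, §7 Thm. 20 (i)] = [KudlaRallis1994, §5] ∕ [Ichino2004] (socket #42F of the #42R road; census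
`K2/K2Liu-p02/g4/CENSUS-42N-ModelIdentification-Ikeda.K2Liup02g4.md` §0, §3).

THE TREE'S CURRENCY (M-155k (2)).  The tree's Schrödinger models are the «Re ∕ Im» models ★ `piSchwartzBruhat K ι` of ★ `adelicGram`; the linear model
is reached by a RATIONAL MOVER (★ `cayleyMover κ`, ★ `ratThetaLiftCont = r_F`, ★ `adelicMpCont.omega`) composed with the rational WITT frame change
(a ★ Levi `twist`), after which the Witt blocks `(Y*⊗X′) ⊕ (Y*⊗a′) ⊕ (Y*⊗X′*)` are an index split `e : ι ≃ (ι₀ ⊕ ι₁) ⊕ ι₃` and Ikeda's operator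
is ★ `fibreIntegral ∘ restrictInl` (p857371).  Hence the DEFINITION OF RECORD, with the movers and the split as PARAMETERS (M-155k (3)):

  `ikedaMap K e ν Mbig Msmall := Msmall ∘ₗ fibreIntegral K ι₀ ι₁ ν ∘ₗ restrictInl K (ι₀ ⊕ ι₁) ι₃ ∘ₗ piSBReindex K e ∘ₗ Mbig`

for a number field `K`, an index split `e`, an additive Haar measure `ν` on `𝔸_K^{ι₁}` (the integrated block `Y*⊗X′`), and linear operators `Mbig`
(INTENDED: `ω(r_F(m(g₀)·κ_big))`, the big Cayley mover followed by the Witt frame change) and `Msmall` (INTENDED: `ω(r_F κ_small)⁻¹`, back to the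
small Re∕Im carrier of ★ `pairRep … (diagonal dD) (JW a′)`).  API: `coe_ikedaMap` ∕ `ikedaMap_apply` (the closed formula
`(Ik Φ)` = `Msmall (x ↦ ∫ (Mbig Φ)((Sum.elim (Sum.elim x y) 0) ∘ e) dν(y))`), `ikedaMap_eq_comp` (the factorisation), and the MOVER-FREE core
`ikedaCore K e ν := fibreIntegral ∘ₗ restrictInl ∘ₗ piSBReindex` with `ikedaMap = Msmall ∘ₗ ikedaCore ∘ₗ Mbig` (`ikedaMap_eq_core`) and its value on
block pure tensors (`ikedaCore_blockTensor`: `Ik(Φ₀ ⊠ Φ₁ ⊠ Φ₃) = (Φ₃(0) · ∫ Φ₁ dν) • Φ₀`).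

NOT here (sequel, M-155k (3)–(4)): the instance `Mbig := ω(r_F(m(g₀)·κ_big))` on the big doubled datum `(dV, tensorFrame dW eW dV′, e′)` of ★ O42.3b and
`Msmall` on the small pair datum (typed with #42F's WORDS, where the Gram data are in scope), the mover-independence of origin values (I4), the
equivariance of `Ik` and the first-term identity (#42F), the model identification (#42N).
HONEST LABEL.  Count-neutral DEFS leaf; it pays nothing by itself: `HC_CM` is proved only modulo the 7 printed citations (2 remaining named inputs:
hLiu418 = `stmt-HodgeConjecture-24832`, h413 = `stmt-HodgeConjecture-24833`) until rung 0 closes.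
References: [GanQiuTakeda2014] §2.7–2.9, §7 Thm. 20; [KudlaRallis1994] §5; [Weil1964] Chap. I n° 11, Chap. III n° 37–41; [Liu2021] App. B p. 104.
-/

set_option autoImplicit false
-- the mandated namespace repeats the single-problem summit's segment (`HodgeConjecture.HodgeConjecture`)
set_option linter.dupNamespace false

noncomputable section

open MeasureTheory NumberField IsDedekindDomain
open scoped Classical
open Literature.NumberTheory.Automorphic Literature.NumberTheory.Weil1964
open Summit.HodgeConjecture.HodgeConjecture.Cruxes.HLiu418.K2LiuSchwartzBruhatFibreIntegralDefs

namespace Summit.HodgeConjecture.HodgeConjecture.Cruxes.HLiu418.K2LiuIkedaMapDefs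

variable (K : Type) [Field K] [NumberField K] {ι ι₀ ι₁ ι₃ : Type} [Fintype ι] [Fintype ι₀] [Fintype ι₁] [Fintype ι₃]
  [MeasurableSpace (AdeleRing (𝓞 K) K)] [BorelSpace (AdeleRing (𝓞 K) K)]
  (e : ι ≃ (ι₀ ⊕ ι₁) ⊕ ι₃) (ν : Measure (ι₁ → AdeleRing (𝓞 K) K)) [ν.IsAddHaarMeasure]

/-! ## §1 The mover-free core `fibreIntegral ∘ restrictInl ∘ reindex` -/

/-- **The mover-free core of Ikeda's map**: split the coordinates along `e : ι ≃ (ι₀ ⊕ ι₁) ⊕ ι₃`, restrict the block `ι₃` (`Y*⊗X′*`) to `0`,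
integrate the block `ι₁` (`Y*⊗X′`) against `ν`, keep the block `ι₀` (`Y*⊗a′`): `𝒮(𝔸_K^ι) →ₗ[ℂ] 𝒮(𝔸_K^{ι₀})`.
[cite: GanQiuTakeda2014, §2.7] [cite: KudlaRallis1994, §5] -/
def ikedaCore : piSchwartzBruhat K ι →ₗ[ℂ] piSchwartzBruhat K ι₀ :=
  fibreIntegral K ι₀ ι₁ ν ∘ₗ restrictInl K (ι₀ ⊕ ι₁) ι₃ ∘ₗ (piSBReindex K e).toLinearMap

/-- closed formula: `(ikedaCore Φ)(x) = ∫ Φ((Sum.elim (Sum.elim x y) 0) ∘ e) dν(y)`. [cite: GanQiuTakeda2014, §2.7] -/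
@[simp] theorem coe_ikedaCore (Φ : piSchwartzBruhat K ι) :
    ((ikedaCore K e ν Φ : piSchwartzBruhat K ι₀) : (ι₀ → AdeleRing (𝓞 K) K) → ℂ) =
      fun x => ∫ y, (Φ : (ι → AdeleRing (𝓞 K) K) → ℂ) ((Sum.elim (Sum.elim x y) (0 : ι₃ → AdeleRing (𝓞 K) K)) ∘ e) ∂ν := rfl

/-- pointwise form of `coe_ikedaCore`. [cite: GanQiuTakeda2014, §2.7] -/
theorem ikedaCore_apply (Φ : piSchwartzBruhat K ι) (x : ι₀ → AdeleRing (𝓞 K) K) :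
    ((ikedaCore K e ν Φ : piSchwartzBruhat K ι₀) : (ι₀ → AdeleRing (𝓞 K) K) → ℂ) x =
      ∫ y, (Φ : (ι → AdeleRing (𝓞 K) K) → ℂ) ((Sum.elim (Sum.elim x y) (0 : ι₃ → AdeleRing (𝓞 K) K)) ∘ e) ∂ν := rfl

/-- **Value on block pure tensors** (separation of variables): for `Φ = R_{e⁻¹}((Φ₀ ⊠ Φ₁) ⊠ Φ₃)` (★ `tensorToSum`, ★ `piSBReindex`),
`ikedaCore Φ = (Φ₃(0) · ∫ Φ₁ dν) • Φ₀`. [cite: GanQiuTakeda2014, §2.7] [cite: Weil1964, Chap. I n° 11 p. 159] -/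
theorem ikedaCore_blockTensor (Φ₀ : piSchwartzBruhat K ι₀) (Φ₁ : piSchwartzBruhat K ι₁) (Φ₃ : piSchwartzBruhat K ι₃) :
    ikedaCore K e ν ((piSBReindex K e).symm (tensorToSum K (ι₀ ⊕ ι₁) ι₃ (tensorToSum K ι₀ ι₁ Φ₀ Φ₁) Φ₃)) =
      ((Φ₃ : (ι₃ → AdeleRing (𝓞 K) K) → ℂ) 0 * ∫ y, (Φ₁ : (ι₁ → AdeleRing (𝓞 K) K) → ℂ) y ∂ν) • Φ₀ := by
  rw [ikedaCore, LinearMap.comp_apply, LinearMap.comp_apply, LinearEquiv.coe_toLinearMap, LinearEquiv.apply_symm_apply,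
    restrictInl_tensorToSum, map_smul, fibreIntegral_tensorToSum, smul_smul]

/-! ## §2 The Ikeda map of record: movers as parameters -/

/-- **THE IKEDA MAP OF RECORD** (LEAD F0P6-plan «M-155k» (2)): `Msmall ∘ (fibreIntegral ∘ restrictInl ∘ reindex e) ∘ Mbig`, with the big
mover `Mbig` (intended `ω(r_F(m(g₀)·κ_big))`: Cayley mover of the big doubled datum followed by the rational Witt frame change of the isotropic
3-space `V′ = X′ ⊕ a′ ⊕ X′*`), the Witt block split `e`, the Haar measure `ν` of the integrated block and the small mover `Msmall` (intended
`ω(r_F κ_small)⁻¹`) as PARAMETERS. [cite: GanQiuTakeda2014, §2.7] [cite: KudlaRallis1994, §5] [cite: Liu2021, App. B p. 104] -/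
def ikedaMap (Mbig : piSchwartzBruhat K ι →ₗ[ℂ] piSchwartzBruhat K ι) (Msmall : piSchwartzBruhat K ι₀ →ₗ[ℂ] piSchwartzBruhat K ι₀) :
    piSchwartzBruhat K ι →ₗ[ℂ] piSchwartzBruhat K ι₀ :=
  Msmall ∘ₗ ikedaCore K e ν ∘ₗ Mbig

/-- `ikedaMap = Msmall ∘ ikedaCore ∘ Mbig`. [cite: GanQiuTakeda2014, §2.7] -/
theorem ikedaMap_eq_core (Mbig : piSchwartzBruhat K ι →ₗ[ℂ] piSchwartzBruhat K ι)
    (Msmall : piSchwartzBruhat K ι₀ →ₗ[ℂ] piSchwartzBruhat K ι₀) :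
    ikedaMap K e ν Mbig Msmall = Msmall ∘ₗ ikedaCore K e ν ∘ₗ Mbig := rfl

/-- the five-fold factorisation `Msmall ∘ fibreIntegral ∘ restrictInl ∘ reindex ∘ Mbig`. [cite: GanQiuTakeda2014, §2.7] -/
theorem ikedaMap_eq_comp (Mbig : piSchwartzBruhat K ι →ₗ[ℂ] piSchwartzBruhat K ι)
    (Msmall : piSchwartzBruhat K ι₀ →ₗ[ℂ] piSchwartzBruhat K ι₀) :
    ikedaMap K e ν Mbig Msmall =
      Msmall ∘ₗ fibreIntegral K ι₀ ι₁ ν ∘ₗ restrictInl K (ι₀ ⊕ ι₁) ι₃ ∘ₗ (piSBReindex K e).toLinearMap ∘ₗ Mbig := rfl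

/-- evaluation: `ikedaMap Φ = Msmall (ikedaCore (Mbig Φ))`. [cite: GanQiuTakeda2014, §2.7] -/
@[simp] theorem ikedaMap_apply (Mbig : piSchwartzBruhat K ι →ₗ[ℂ] piSchwartzBruhat K ι)
    (Msmall : piSchwartzBruhat K ι₀ →ₗ[ℂ] piSchwartzBruhat K ι₀) (Φ : piSchwartzBruhat K ι) :
    ikedaMap K e ν Mbig Msmall Φ = Msmall (ikedaCore K e ν (Mbig Φ)) := rfl

/-- the closed formula before the small mover: `ikedaCore (Mbig Φ)` is `x ↦ ∫ (Mbig Φ)((Sum.elim (Sum.elim x y) 0) ∘ e) dν(y)`.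
[cite: GanQiuTakeda2014, §2.7] -/
theorem coe_ikedaCore_comp (Mbig : piSchwartzBruhat K ι →ₗ[ℂ] piSchwartzBruhat K ι) (Φ : piSchwartzBruhat K ι) :
    ((ikedaCore K e ν (Mbig Φ) : piSchwartzBruhat K ι₀) : (ι₀ → AdeleRing (𝓞 K) K) → ℂ) =
      fun x => ∫ y, ((Mbig Φ : piSchwartzBruhat K ι) : (ι → AdeleRing (𝓞 K) K) → ℂ)
        ((Sum.elim (Sum.elim x y) (0 : ι₃ → AdeleRing (𝓞 K) K)) ∘ e) ∂ν := rfl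

/-- with trivial movers the Ikeda map is its core. [cite: GanQiuTakeda2014, §2.7] -/
theorem ikedaMap_id_id : ikedaMap K e ν LinearMap.id LinearMap.id = ikedaCore K e ν := rfl

end Summit.HodgeConjecture.HodgeConjecture.Cruxes.HLiu418.K2LiuIkedaMapDefs

end
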